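import Literature.MathematicalPhysics.QuantumFieldTheory.BalabanImbrieJaffe1984to88.BIJ88Eq531SmallF
import Literature.MathematicalPhysics.QuantumFieldTheory.BalabanImbrieJaffe1984to88.BIJ85AxialGaugeFixTorus

/-!
# `BalabanImbrieJaffe1984to88.BIJ88SmallBlockFields332` — T. Bałaban, J. Imbrie, A. Jaffe, *Effective action and cluster properties of the
abelian Higgs model*, Commun. Math. Phys. **114** (1988) 257–315 [BalabanImbrieJaffe1988], p. 267 **(3.15)** ⟹ p. 270 **(3.32)**:
*"In the small field region Λ₀^{(0)} we have small block fields: |v(p) − 1| ≦ ce₀p(e₀), |ψ(y)| ≦ cp(e₀)λ₀^{−1/4},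
|(D_{ū₁}ψ)(b′)| ≦ cp(e₀), b′ ∈ Λ₀^{(0)′*}, (3.32) where ū₁(b′) = ū₁(⟨b′₋, b′₊⟩). We change nothing, then, by inserting a factor
χ_{1,Λ₀^{(0)′}}(v, ψ) which enforces these conditions"* — PROVED for r18's TYPED PREDICATES `BIJ88Sect3Statements.SmallField315` (3.15)
and `BIJ88Sect3Statements.SmallBlock332` (3.32) AT THE OBJECTS OF RECORD on the torus carrier, one renormalization step, with the
constant `c = 17d²L²` explicit.

statement-level skeleton of published theorems with citation tags; proofs where landed; nothing here is a claim about the Yang–Mills mass gap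

PDF held: `paper:balaban1988-cmp114-bij-abelian-higgs-effective-action` (journal page = PDF page + 256); pp. 266–270 [PDF 10–14] read this
session from the text layer (`lit read … --pages 9-15`); [BalabanImbrieJaffe1985] (`paper:balaban1985-cmp97-bij-higgs-minimizers`) Chap. 2
pp. 302–303 ((2.4)–(2.6), (2.10)–(2.11)) through the verbatim quotations in the header of `BIJ85BlockAveragesTorus`.

CITATION HEADER (lean-in-tree rule).  Part of the lit-balaban TYPED SKELETON (HOME `run/shared/lean/pub/lit-balaban/`), PHASE-2 proof
seat p30 gen 32 (unit `lit-balaban-p30`; TAKING line HOME/STATUS.md 2026-08-23T11:31:27Z).  WHAT IS REPRODUCED: the two MEMBERS OWED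
named by the fold owner's reading-rule audit (`HOME/lit-balaban-r18/AUDIT-C2S14-DEF-g26.md`, rows **C2.Eq3.15** and **C2.Eq3.32** of
`HOME/lit-balaban-r18/ROWS-C2.md`): (i) (3.15) INSTANTIATED at the objects of record — the covariant derivative `D_uφ = covD 1 (cfg U) φ`
((3.3), unit fine lattice `T₁`), the covariant block average `Q(u)φ = BIJ85BlockAveragesTorus.qCov U φ` ([BalabanImbrieJaffe1985] (2.6)),
the field strength `f^{(0)}(p) = (ie₀)⁻¹ log u(p)` read through `BIJ88Sect3Statements.fieldStrength` of `plaqVar (cfg U) p` (3.26) — and its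
fourth clause turned into the plaquette hypothesis `|argB u(∂p)| ≤ e₀p(e₀)` that every small-field theorem of the tree consumes (p31's
`BIJ88Eq531SmallF.smallF_of_plaquettes`, `BIJ88Eq531SmallAPrime.smallAPrime_of_plaquettes`, p34's `smallPlaquette_actualBg`):
`plaqSmall_of_smallField315`; (ii) the CLAIM (3.15) ⟹ (3.32) for the block fields of record `v = Qu = BIJ85BlockAveragesTorus.qU U`
([BalabanImbrieJaffe1985] (2.10)–(2.11)) and `ψ`, clause by clause: `|v(p′) − 1| ≤ 17d²L²·e₀p(e₀)` (`norm_plaqVar_qU_sub_one_le`, p31's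
`abs_argB_plaqHol_qU_le` BY NAME), `|ψ(y)| ≤ 2λ₀^{−1/4}p(e₀)` (`norm_psi_le_of_smallField315`, the triangle inequality through `Q(u)φ`),
`|(D_vψ)(b′)| ≤ c′(L + 3)p(e₀)` (`norm_covD_qU_psi_le_of_smallField315`) from THE COVARIANT-AVERAGE LIPSCHITZ IDENTITY
`v(b′)(Q(u)φ)(y′) − (Q(u)φ)(y) = L^{−d} Σ_{x∈B(y)} u(Γ_{yx})[e^{i·loopAvg} u(loop_x)^{−1} u(Γ_{xx′})φ(x′) − φ(x)]` (`qU_mul_qCov_shift_sub_eq`; the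
loops are exactly the closed contours `Γ_{yx} ∘ Γ_{xx′} ∘ Γ_{y′x′}^{−1} ∘ Γ_{y′y}` of (2.10), `BIJ85BlockAveragesTorus.loopC`, and
`u(Γ_{xx′})φ(x′) − φ(x) = Σ_{t<L} u(Γ_{x,x+te_μ})(D_uφ)(⟨x + te_μ, μ⟩)` telescopes along the straight run), bounded by p31's
`BIJ88Eq531SmallAPrime.abs_argB_loopC_le` / `abs_loopAvg_le` BY NAME; whence `smallBlock332_of_smallField315`:
`SmallField315 p(e₀) λ₀ Λ Λ′ (D_uφ) ψ (Q(u)φ) φ f^{(0)} → SmallBlock332 (17d²L²) e₀ p(e₀) λ₀ Λ′ (v(∂·)) ψ (D_vψ)`.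

READING DISCLOSED (the owner r18 decides the heads; this file supplies located members).  (a) Print's `ū₁` (*"where ū₁(b′) =
ū₁(⟨b′₋, b′₊⟩)"*) is read (OUR READING) as the transport along the straight `L`-lattice bond `⟨b′₋, b′₊⟩` of the background field of p. 270,
*"a background gauge field u₁ = (Λ₁^{(0)*}Q^{s*}v)(Λ₆^{(0)*c}u^{(0)}) exp(ie₀Λ₄^{(0)*}L^{−2}C^{(0)}_{loc}∂^*Q^{e*}f). Here u^{(0)} = exp(ie₀A^{(0)})."*
(PDF p. 14 read as an image this session): along that bond the factor `Q^{s*}v` transports to `v(b′)` itself (`Q^sQ^{s*} = I`,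
[BalabanImbrieJaffe1985] (2.19)), so the member is stated for `D_v`, `v = Qu`; the remaining factors (the `Λ₆^{(0)*c}u^{(0)}` phase and the
(3.27)/(3.28) correction `exp(ie₀Λ₄^{(0)*}L^{−2}C^{(0)}_{loc}∂^*Q^{e*}f)`) belong to rows C2.Eq3.27/3.28 (NOT taken here) and are covered
abstractly by `norm_covD_perturb_le`: `|(D_wψ)(b′)| ≤ |(D_vψ)(b′)| + c′|w(b′) − v(b′)|·|ψ(b′₊)|` for ANY coarse bond field `w`.
(b) The integration variable `u` of (3.11) carries the axial gauge `δ_{Ax}(u)`; the loop estimates of p31 are stated in that gauge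
(`BIJ88RenormTransf311.DeltaAx`), and so are the bounds here (the identity `qU_mul_qCov_shift_sub_eq` holds for every `u`).  (c) LOCATED
MARGIN: print asserts (3.32) on `Λ₀^{(0)′*}` for `Λ₀^{(0)}` *"composed of r(e₀)-cubes"* (p. 267) and works thereafter on sets *"obtained
from Λ₀^{(0)} … by deleting r(e₀)-cubes at the boundary"*; the members take the pair `(Λ, Λ′)` with the explicit margin «every fine site /
every fine plaquette based in a block of `Λ′` lies in `Λ` / in `Λ**`» (`hΛ₁`, `hΛ₂`), which holds for the block sites of any such shrunk set.
(d) Smallness: `17d²L²·e₀p(e₀) < π` (the branch (2.11) stays additive) and `2·17d²L²·e₀p(e₀) ≤ λ₀^{1/4}`, `0 < λ₀ ≤ 1` — the printed regime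
`e₀` small, `e₀²/λ₀ = O(1)` (p. 266).  (e) Lattice units: fine spacing `1` (`covD 1`), coarse covariant derivative with any prefactor
`0 ≤ c′ ≤ 1` (`covD c′`, covering `c′ = 1` and `c′ = L⁻¹`).

No `def`s, no new `def … : Prop`, no `sorry`; private lemmas are arithmetic / telescoping kernels.  Axioms: {propext, Classical.choice,
Quot.sound}.  Unit `lit-balaban-p30` gen 32 (literature-prover-lit-balaban-p30-g32-0), 2026-08-23.

v1.1 (append-only, same seat and gen): §6 — READING (b) DISCHARGED: **(3.15) ⟹ (3.32) for EVERY `U(1)` field, no gauge condition**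
(`smallBlock332_of_smallField315_all`).  Every quantity in (3.15) and (3.32) is gauge covariant with gauge-invariant modulus, and the
axial-gauge fixing `h(x) = u(Γ_{yx})` of [BalabanImbrieJaffe1985] p. 303 (`BIJ85AxialGaugeFixTorus.holFix`, `deltaAx_gaugeAct_holFix`) is
`1` at every block corner (`holFix_corner`), so it leaves the block fields `Q(u)φ`, `Qu` and hence `ψ`, `v`, `D_vψ` UNCHANGED
(`qCov_gaugeAct_holFix`, `qU_gaugeAct_holFix`) while `|D_uφ|`, `|φ|`, `|u(∂p)|` are invariant (`norm_covD_gaugeAct_twist`,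
`toC_plaqHol_gaugeAct`): (3.15) transfers to the axial representative (`smallField315_gaugeAct_holFix`) and §5 applies.  v1.1 adds the import
`BIJ85AxialGaugeFixTorus`; nothing of v1.0 is changed.

v1.2 (DOCSTRING-ONLY, same seat and gen): the (3.32) sentence *"where ū₁(b′) = ū₁(⟨b′₋, b′₊⟩)"* and the p. 270 display of `u₁` are now quoted
verbatim from the page image (v1.0/v1.1 carried a text-layer transcription of the `u₁` display and `u₁` for the second `ū₁`); READING (a)
rephrased accordingly and labelled ours.  Declarations byte-identical to v1.1.
-/

namespace Literature.MathematicalPhysics.QuantumFieldTheory.BalabanImbrieJaffe1984to88.BIJ88SmallBlockFields332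

open Literature.MathematicalPhysics.QuantumFieldTheory.Balaban1983to89
open BIJ88Sect3Statements (U1 toC toC_mul toC_one norm_toC cfg covD plaqVar plaqVar_cfg fieldStrength starB starP
  SmallField315 SmallBlock332)
open BIJ85Sect1Model (HiggsField argB argB_mem_Ico)
open BIJ88RenormTransf311 (inBlock DeltaAx)
open BIJ85BlockAveragesTorus
open BIJ88Eq531SmallAPrime (abs_argB_loopC_le abs_loopAvg_le exp_argB_mul_I_of_norm abs_argB_le_pi offs_blockSite)
open BIJ88Eq531SmallF (abs_argB_plaqHol_qU_le const_le_seventeen)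
open GaugeField (plaqHol gaugeAct)
open scoped BigOperators Real
open Complex Finset

noncomputable section

variable {P : Params} {j : ℕ}


/-! ## §0  Scalar kernels on the unit circle -/

/-- kernel: `‖e^{iθ} − 1‖ ≤ |θ|` (chord ≤ arc). [folklore] -/
private theorem norm_cexp_mul_I_sub_one_le (θ : ℝ) : ‖Complex.exp ((θ : ℂ) * I) - 1‖ ≤ |θ| := by
  have h := Real.norm_exp_I_mul_ofReal_sub_one_le (x := θ)
  rw [mul_comm] at h
  simpa [Real.norm_eq_abs] using h

/-- kernel: a product of unit complex numbers has norm one. [folklore] -/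
private theorem norm_prod_toC_eq_one {ι : Type*} (s : Finset ι) (f : ι → U1) : ‖∏ i ∈ s, toC (f i)‖ = 1 := by
  rw [norm_prod]
  exact prod_eq_one fun _ _ => norm_toC _

/-- kernel: `|u(Γ_{xx′})| = 1`. [cite: BalabanImbrieJaffe1985, (2.10) p.303] -/
private theorem norm_runC_eq_one (U : GaugeField P j U1) (x : Balaban1983to89.Site P j) (μ : Fin P.d) : ‖runC U x μ‖ = 1 :=
  norm_prod_toC_eq_one _ _

/-- kernel: the loop variable of (2.10) is a unit complex number. [cite: BalabanImbrieJaffe1985, (2.10) p.303] -/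
private theorem norm_loopC_eq_one (U : GaugeField P j U1) (c : PBond P (j+1)) (x : Balaban1983to89.Site P j) : ‖loopC U c x‖ = 1 := by
  unfold loopC
  rw [norm_mul, norm_mul, norm_mul, norm_inv, norm_inv, norm_holC, norm_holC, norm_runC_eq_one, norm_runC_eq_one]
  norm_num

/-- kernel: `|Complex.arg z| = |argB z|` (the two branches differ only at `z = −1`, by a sign). [cite: BalabanImbrieJaffe1985, (2.11) p.303] -/
private theorem abs_arg_eq_abs_argB (z : ℂ) : |Complex.arg z| = |argB z| := by
  unfold argB
  split_ifs with h
  · rw [h, abs_neg]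
  · rfl

/-- **(3.26) read on the unit circle**: for `|z| = 1` the principal-branch field strength `(ie₀)⁻¹ log z` has modulus `|argB z| / |e₀|`
(`log z = i·arg z`, and `|arg z| = |argB z|`). [cite: BalabanImbrieJaffe1988, (3.26) p.269] -/
theorem norm_fieldStrength_of_norm_one {e₀ : ℝ} (he : e₀ ≠ 0) {z : ℂ} (hz : ‖z‖ = 1) :
    ‖fieldStrength e₀ z‖ = |argB z| / |e₀| := by
  have hlog : Complex.log z = (Complex.arg z : ℂ) * I := by
    apply Complex.ext
    · simp [Complex.log_re, hz]
    · simp [Complex.log_im]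
  have hf : fieldStrength e₀ z = ((Complex.arg z / e₀ : ℝ) : ℂ) := by
    unfold fieldStrength
    have he' : (e₀ : ℂ) ≠ 0 := ofReal_ne_zero.2 he
    rw [hlog, ofReal_div, mul_inv, div_eq_mul_inv,
      show (I : ℂ)⁻¹ * (↑e₀)⁻¹ * (↑(Complex.arg z) * I) = ↑(Complex.arg z) * (↑e₀)⁻¹ * (I⁻¹ * I) by ring,
      inv_mul_cancel₀ I_ne_zero, mul_one]
  rw [hf, Complex.norm_real, Real.norm_eq_abs, abs_div, abs_arg_eq_abs_argB]

/-- **(3.26) for a plaquette variable of the model**: `‖(ie₀)⁻¹ log u(∂p)‖ = |argB u(∂p)| / e₀` (`e₀ > 0`; `u(∂p) = plaqVar (cfg U) p` is the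
tree's `plaqHol` read in `ℂ`, `plaqVar_cfg`). [cite: BalabanImbrieJaffe1988, (3.26) p.269] -/
theorem norm_fieldStrength_plaqVar {e₀ : ℝ} (he : 0 < e₀) (U : GaugeField P j U1) (p : Balaban1983to89.Plaq P j) :
    ‖fieldStrength e₀ (plaqVar (cfg U) p)‖ = |argB (toC (plaqHol U p))| / e₀ := by
  rw [plaqVar_cfg, norm_fieldStrength_of_norm_one he.ne' (norm_toC _), abs_of_pos he]

/-! ## §1  (3.15) at the objects of record: the fourth clause is the plaquette hypothesis of the tree -/

/-- **(3.15), fourth clause, at the objects of record** (p. 267: *"|f^{(0)}(p)| ≦ p(e₀), where f^{(0)}(p) = (ie₀)⁻¹ log u(p)"*): if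
`SmallField315 p(e₀) λ₀ Λ Λ′ Dφ ψ Qφ φ f^{(0)}` holds with `f^{(0)}(p) = ‖fieldStrength e₀ (plaqVar (cfg U) p)‖`, then
**`|argB u(∂p)| ≤ e₀·p(e₀)` for every plaquette `p ∈ Λ**`** — the hypothesis shape of `BIJ88Eq531SmallF.smallF_of_plaquettes` /
`BIJ88Eq531SmallAPrime.smallAPrime_of_plaquettes`. [cite: BalabanImbrieJaffe1988, (3.15) p.267] -/
theorem plaqSmall_of_smallField315 {e₀ pe₀ lam₀ : ℝ} (he : 0 < e₀) {Λ : Finset (Balaban1983to89.Site P j)}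
    {Λ' : Finset (Balaban1983to89.Site P (j+1))} {Dφ : PBond P j → ℂ} {ψ Qφ : Balaban1983to89.Site P (j+1) → ℂ}
    {φ : Balaban1983to89.Site P j → ℂ} {U : GaugeField P j U1}
    (h : SmallField315 pe₀ lam₀ Λ Λ' Dφ ψ Qφ φ (fun p => ‖fieldStrength e₀ (plaqVar (cfg U) p)‖)) :
    ∀ p ∈ starP Λ, |argB (toC (plaqHol U p))| ≤ e₀ * pe₀ := by
  intro p hp
  have h4 := h.2.2.2 p hp
  dsimp only at h4
  rw [abs_of_nonneg (norm_nonneg _), norm_fieldStrength_plaqVar he, div_le_iff₀ he] at h4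
  linarith

/-- kernel: membership in `X**` unpacked. [cite: BalabanImbrieJaffe1988, (3.15) p.267] -/
private theorem mem_starP {X : Finset (Balaban1983to89.Site P j)} {p : Balaban1983to89.Plaq P j} :
    p ∈ starP X ↔ p.src ∈ X ∧ p.src.shift p.μ ∈ X ∧ p.src.shift p.ν ∈ X ∧ (p.src.shift p.μ).shift p.ν ∈ X := by
  simp [starP]

/-- kernel: membership in `X*` unpacked. [cite: BalabanImbrieJaffe1988, (3.15) p.267] -/
private theorem mem_starB {X : Finset (Balaban1983to89.Site P j)} {b : PBond P j} : b ∈ starB X ↔ b.src ∈ X ∧ b.tgt ∈ X := by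
  simp [starB]

/-- kernel: `N₃ ≤ L² + 4N₃ ≤ 17d²L²` in `ℝ` (`N₃ = (L−1)N₁ + N₁(1 + 2N₁)`, `N₁ = (d−1)(L−1)`, the loop constant of
`BIJ88Eq531SmallAPrime.abs_argB_loopC_le`; `L² + 4N₃` the constant of `BIJ88Eq531SmallF.abs_argB_plaqHol_qU_le`).
[cite: BalabanImbrieJaffe1988, (5.3.1) p.280] -/
private theorem loopConst_le_seventeen :
    (((P.L - 1) * ((P.d - 1) * (P.L - 1)) + (P.d - 1) * (P.L - 1) * (1 + 2 * ((P.d - 1) * (P.L - 1))) : ℕ) : ℝ)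
        ≤ 17 * (P.d : ℝ) ^ 2 * (P.L : ℝ) ^ 2 ∧
    ((P.L ^ 2 + 4 * ((P.L - 1) * ((P.d - 1) * (P.L - 1)) + (P.d - 1) * (P.L - 1) * (1 + 2 * ((P.d - 1) * (P.L - 1)))) : ℕ) : ℝ)
      ≤ 17 * (P.d : ℝ) ^ 2 * (P.L : ℝ) ^ 2 := by
  have h17 : ((P.L ^ 2 + 4 * ((P.L - 1) * ((P.d - 1) * (P.L - 1)) + (P.d - 1) * (P.L - 1) * (1 + 2 * ((P.d - 1) * (P.L - 1)))) : ℕ) : ℝ)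
      ≤ 17 * (P.d : ℝ) ^ 2 * (P.L : ℝ) ^ 2 := by
    calc ((P.L ^ 2 + 4 * ((P.L - 1) * ((P.d - 1) * (P.L - 1)) + (P.d - 1) * (P.L - 1) * (1 + 2 * ((P.d - 1) * (P.L - 1)))) : ℕ) : ℝ)
        ≤ ((17 * P.d ^ 2 * P.L ^ 2 : ℕ) : ℝ) := by exact_mod_cast const_le_seventeen (P := P)
      _ = 17 * (P.d : ℝ) ^ 2 * (P.L : ℝ) ^ 2 := by push_cast; ring
  refine ⟨le_trans ?_ h17, h17⟩
  exact_mod_cast (show (P.L - 1) * ((P.d - 1) * (P.L - 1)) + (P.d - 1) * (P.L - 1) * (1 + 2 * ((P.d - 1) * (P.L - 1))) ≤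
    P.L ^ 2 + 4 * ((P.L - 1) * ((P.d - 1) * (P.L - 1)) + (P.d - 1) * (P.L - 1) * (1 + 2 * ((P.d - 1) * (P.L - 1)))) by omega)

/-! ## §2  (3.32), first clause: `|v(p′) − 1| ≤ c·e₀p(e₀)` for `v = Qu` -/

/-- **(3.32), first clause** *"|v(p) − 1| ≦ ce₀p(e₀)"* for the block gauge field `v = Qu` of [BalabanImbrieJaffe1985] (2.10) and every
`L`-lattice plaquette `p′ ∈ Λ′**`, from the plaquette restriction `|argB u(∂p)| ≤ ε` on `Λ**` (= the fourth clause of (3.15),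
`plaqSmall_of_smallField315`) under the margin `hΛ₂` and the axial gauge: **`‖v(∂p′) − 1‖ ≤ 17d²L²·ε`** — p31's `abs_argB_plaqHol_qU_le`
(`|argB v(∂p′)| ≤ (L² + 4N₃)ε`) and `‖e^{iθ} − 1‖ ≤ |θ|`. [cite: BalabanImbrieJaffe1988, (3.32) p.270] -/
theorem norm_plaqVar_qU_sub_one_le (hj : j + 1 ≤ P.m + P.K) {U : GaugeField P j U1} (hU : DeltaAx U) {ε : ℝ} (hε₀ : 0 ≤ ε)
    {Λ : Finset (Balaban1983to89.Site P j)} {Λ' : Finset (Balaban1983to89.Site P (j+1))}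
    (hΛ₂ : ∀ p : Balaban1983to89.Plaq P j, blockOf p.src ∈ Λ' → p ∈ starP Λ)
    (hsmall : ∀ p ∈ starP Λ, |argB (toC (plaqHol U p))| ≤ ε) (hπ : 17 * (P.d : ℝ) ^ 2 * (P.L : ℝ) ^ 2 * ε < π)
    (q : Balaban1983to89.Plaq P (j+1)) (hq : q ∈ starP Λ') :
    ‖plaqVar (cfg (qU U)) q - 1‖ ≤ 17 * (P.d : ℝ) ^ 2 * (P.L : ℝ) ^ 2 * ε := by
  obtain ⟨h1, h2, h3, h4⟩ := mem_starP.1 hq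
  have hε : ∀ p : Balaban1983to89.Plaq P j, blockOf p.src = q.src ∨ blockOf p.src = q.src.shift q.μ ∨
      blockOf p.src = q.src.shift q.ν ∨ blockOf p.src = (q.src.shift q.μ).shift q.ν → |argB (toC (plaqHol U p))| ≤ ε := by
    intro p hp
    refine hsmall p (hΛ₂ p ?_)
    rcases hp with hp | hp | hp | hp <;> rw [hp] <;> assumption
  have hv := abs_argB_plaqHol_qU_le hj hU hε₀ q hε (lt_of_le_of_lt (mul_le_mul_of_nonneg_right loopConst_le_seventeen.2 hε₀) hπ)
  rw [plaqVar_cfg]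
  have hunit : ‖toC (plaqHol (qU U) q)‖ = 1 := norm_toC _
  calc ‖toC (plaqHol (qU U) q) - 1‖ = ‖Complex.exp ((argB (toC (plaqHol (qU U) q)) : ℂ) * I) - 1‖ := by
        rw [exp_argB_mul_I_of_norm hunit]
    _ ≤ |argB (toC (plaqHol (qU U) q))| := norm_cexp_mul_I_sub_one_le _
    _ ≤ _ := hv
    _ ≤ 17 * (P.d : ℝ) ^ 2 * (P.L : ℝ) ^ 2 * ε := mul_le_mul_of_nonneg_right loopConst_le_seventeen.2 hε₀

/-! ## §3  (3.32), second clause: `|ψ(y)| ≤ 2λ₀^{−1/4}p(e₀)` -/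

/-- **The covariant block average is a contraction in sup norm**: `|(Q(u)φ)(y)| ≤ max_{B(y)} |φ|`, since `|u(Γ_{yx})| = 1` and `|B(y)| = L^d`
([BalabanImbrieJaffe1985] (2.6)). [cite: BalabanImbrieJaffe1985, (2.6) p.303] -/
theorem norm_qCov_le (hj : j + 1 ≤ P.m + P.K) (U : GaugeField P j U1) {φ : HiggsField P j} {M : ℝ}
    (y : Balaban1983to89.Site P (j+1)) (hφ : ∀ x ∈ block y, ‖φ x‖ ≤ M) : ‖qCov U φ y‖ ≤ M := by
  have hL : (0 : ℝ) < (P.L : ℝ) ^ P.d := by have := P.L_pos; positivity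
  rw [qCov_apply, norm_mul, norm_inv, norm_pow, Complex.norm_natCast]
  have hsum : ‖∑ x ∈ block y, holC U x * φ x‖ ≤ (block y).card * M := by
    refine (norm_sum_le _ _).trans ((sum_le_sum fun x hx => ?_).trans_eq (by rw [sum_const, nsmul_eq_mul]))
    rw [norm_mul, norm_holC, one_mul]
    exact hφ x hx
  rw [Balaban1983to89.Site.card_block hj, Nat.cast_pow] at hsum
  calc ((P.L : ℝ) ^ P.d)⁻¹ * ‖∑ x ∈ block y, holC U x * φ x‖ ≤ ((P.L : ℝ) ^ P.d)⁻¹ * ((P.L : ℝ) ^ P.d * M) :=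
        mul_le_mul_of_nonneg_left hsum (inv_nonneg.2 hL.le)
    _ = M := by field_simp

/-- **(3.32), second clause** *"|ψ(y)| ≦ cp(e₀)λ₀^{−1/4}"* from the second and third clauses of (3.15) (*"|ψ − Q(u)φ| ≦ p(e₀),
|φ| ≦ λ₀^{−1/4}p(e₀)"*): `|ψ(y)| ≤ |ψ(y) − (Q(u)φ)(y)| + |(Q(u)φ)(y)| ≤ p(e₀) + λ₀^{−1/4}p(e₀) ≤ 2λ₀^{−1/4}p(e₀)` for `0 < λ₀ ≤ 1` and
`y ∈ Λ′` with `B(y) ⊆ Λ` (`hΛ₁`). [cite: BalabanImbrieJaffe1988, (3.32) p.270] -/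
theorem norm_psi_le_of_smallField315 (hj : j + 1 ≤ P.m + P.K) {pe₀ lam₀ : ℝ} (hpe : 0 ≤ pe₀) (hlam : 0 < lam₀) (hlam1 : lam₀ ≤ 1)
    {Λ : Finset (Balaban1983to89.Site P j)} {Λ' : Finset (Balaban1983to89.Site P (j+1))} {Dφ : PBond P j → ℂ}
    {ψ : Balaban1983to89.Site P (j+1) → ℂ} {φ : HiggsField P j} {U : GaugeField P j U1} {f0 : Balaban1983to89.Plaq P j → ℝ}
    (h : SmallField315 pe₀ lam₀ Λ Λ' Dφ ψ (qCov U φ) φ f0)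
    (hΛ₁ : ∀ x : Balaban1983to89.Site P j, blockOf x ∈ Λ' → x ∈ Λ)
    (y : Balaban1983to89.Site P (j+1)) (hy : y ∈ Λ') :
    ‖ψ y‖ ≤ 2 * pe₀ * lam₀ ^ (-(1 / 4 : ℝ)) := by
  have hpow : 1 ≤ lam₀ ^ (-(1 / 4 : ℝ)) :=
    Real.one_le_rpow_of_pos_of_le_one_of_nonpos hlam hlam1 (by norm_num)
  have h2 := h.2.1 y hy
  have h3 : ‖qCov U φ y‖ ≤ lam₀ ^ (-(1 / 4 : ℝ)) * pe₀ :=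
    norm_qCov_le hj U y fun x hx => h.2.2.1 x (hΛ₁ x (by rw [mem_block_iff.1 hx]; exact hy))
  calc ‖ψ y‖ = ‖(ψ y - qCov U φ y) + qCov U φ y‖ := by rw [sub_add_cancel]
    _ ≤ ‖ψ y - qCov U φ y‖ + ‖qCov U φ y‖ := norm_add_le _ _
    _ ≤ pe₀ + lam₀ ^ (-(1 / 4 : ℝ)) * pe₀ := add_le_add h2 h3
    _ ≤ 2 * pe₀ * lam₀ ^ (-(1 / 4 : ℝ)) := by nlinarith

/-! ## §4  (3.32), third clause: the covariant-average Lipschitz identity and `|(D_vψ)(b′)| ≤ c p(e₀)` -/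

/-- kernel: telescoping of a transported difference along a path: `(Π_{t<n} u_t)·g(n) − g(0) = Σ_{t<n} (Π_{s<t} u_s)(u_t g(t+1) − g(t))`.
[folklore] -/
private theorem prod_mul_sub_eq_sum (u g : ℕ → ℂ) (n : ℕ) :
    (∏ t ∈ range n, u t) * g n - g 0 = ∑ t ∈ range n, (∏ s ∈ range t, u s) * (u t * g (t + 1) - g t) := by
  induction n with
  | zero => simp
  | succ n ih =>
    rw [sum_range_succ, ← ih, prod_range_succ]
    ring

/-- **`u(Γ_{xx′})φ(x′) − φ(x)` telescopes into covariant derivatives along the straight run** `x, x + e_μ, …, x′ = x + Le_μ`: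
`‖u(Γ_{xx′})φ(x′) − φ(x)‖ ≤ Σ_{t<L} ‖(D_uφ)(⟨x + te_μ, μ⟩)‖` (`D_uφ = covD 1 (cfg U) φ`, `|u| = 1`). [cite: BalabanImbrieJaffe1988, (3.32) p.270] -/
theorem norm_runC_mul_sub_le (U : GaugeField P j U1) (φ : HiggsField P j) (x : Balaban1983to89.Site P j) (μ : Fin P.d) :
    ‖runC U x μ * φ (runSite x μ P.L) - φ x‖ ≤ ∑ t ∈ range P.L, ‖covD 1 (cfg U) φ (runBond x μ t)‖ := by
  have key := prod_mul_sub_eq_sum (fun t => toC (U (runBond x μ t))) (fun t => φ (runSite x μ t)) P.L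
  simp only [runSite_zero] at key
  rw [show runC U x μ = ∏ t ∈ range P.L, toC (U (runBond x μ t)) from rfl, key]
  refine (norm_sum_le _ _).trans (sum_le_sum fun t _ => ?_)
  rw [norm_mul, norm_prod_toC_eq_one, one_mul]
  apply le_of_eq
  congr 1
  rw [show covD 1 (cfg U) φ (runBond x μ t) = ((1 : ℝ) : ℂ) * (cfg U (runBond x μ t) * φ (runBond x μ t).tgt - φ (runBond x μ t).src)
    from rfl, runBond_tgt]
  simp [cfg, runBond]

/-- kernel: a sum over the block `B(y + e_μ)` is the sum over `B(y)` of the translates `x ↦ x + Le_μ` (the runs of (2.10) end in the next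
block with the same offsets, `runSite_L`). [cite: BalabanImbrieJaffe1985, (2.10) p.303] -/
private theorem sum_block_shift (hj : j + 1 ≤ P.m + P.K) (y : Balaban1983to89.Site P (j+1)) (μ : Fin P.d) (g : Balaban1983to89.Site P j → ℂ) :
    ∑ x' ∈ block (y.shift μ), g x' = ∑ x ∈ block y, g (runSite x μ P.L) := by
  symm
  refine sum_nbij' (fun x => runSite x μ P.L) (fun x' => Balaban1983to89.Site.blockSite y (offs x')) ?_ ?_ ?_ ?_ ?_
  · intro x hx
    rw [mem_block_iff] at hx ⊢
    rw [blockOf_runSite_L hj, hx]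
  · intro x' _
    exact mem_block_iff.2 (Balaban1983to89.Site.blockOf_blockSite hj _ _)
  · intro x hx
    have hoffs : offs (runSite x μ P.L) = offs x := funext fun κ => Fin.ext (by rw [coe_offs, coe_offs, inBlock_runSite_L hj])
    rw [hoffs, ← mem_block_iff.1 hx, blockSite_offs hj]
  · intro x' hx'
    rw [runSite_L hj, Balaban1983to89.Site.blockOf_blockSite hj, offs_blockSite hj, ← mem_block_iff.1 hx', blockSite_offs hj]
  · intro x _
    rfl

/-- **THE COVARIANT-AVERAGE LIPSCHITZ IDENTITY** ([BalabanImbrieJaffe1985] Chap. 2 mechanics behind (3.32); every `u`, no gauge condition):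
for the `L`-lattice bond `b′ = ⟨y, y′ = y + e_μ⟩`,
`v(b′)·(Q(u)φ)(y′) − (Q(u)φ)(y) = L^{−d} Σ_{x∈B(y)} u(Γ_{yx})·[e^{i·loopAvg(b′)}·u(loop_x)^{−1}·u(Γ_{xx′})φ(x′) − φ(x)]`, `x′ = x + Le_μ`,
where `v = Qu` is (2.10) (`toC_qU`: `v(b′) = u(Γ_{yy′})e^{i·loopAvg}`) and `loop_x = Γ_{yx} ∘ Γ_{xx′} ∘ Γ_{y′x′}^{−1} ∘ Γ_{y′y}` its closed contour
(`loopC`) — the prefactor `u(Γ_{yy′})` of `v` CANCELS against the loop. [cite: BalabanImbrieJaffe1988, (3.32) p.270] -/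
theorem qU_mul_qCov_shift_sub_eq (hj : j + 1 ≤ P.m + P.K) (U : GaugeField P j U1) (φ : HiggsField P j)
    (y : Balaban1983to89.Site P (j+1)) (μ : Fin P.d) :
    toC (qU U ⟨y, μ⟩) * qCov U φ (y.shift μ) - qCov U φ y =
      ((P.L : ℂ) ^ P.d)⁻¹ * ∑ x ∈ block y, holC U x *
        (Complex.exp ((loopAvg U ⟨y, μ⟩ : ℂ) * I) * (loopC U ⟨y, μ⟩ x)⁻¹ * (runC U x μ * φ (runSite x μ P.L)) - φ x) := by
  rw [qCov_apply, qCov_apply, sum_block_shift hj y μ (fun x' => holC U x' * φ x'), mul_left_comm, ← mul_sub, mul_sum,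
    ← sum_sub_distrib]
  congr 1
  refine sum_congr rfl fun x _ => ?_
  rw [toC_qU]
  unfold loopC
  dsimp only
  have h1 := holC_ne_zero U x
  have h2 := runC_ne_zero U x μ
  have h3 := holC_ne_zero U (runSite x μ P.L)
  have h4 := runC_ne_zero U (corner y) μ
  field_simp

/-- **The covariant-average Lipschitz bound** (one block step; axial gauge): if `|argB u(∂p)| ≤ ε` on the plaquettes of the two blocks
`B(y)`, `B(y + e_μ)`, `Nε < π` for a constant `N ≥ N₃` (`N₃ = (L−1)N₁ + N₁(1 + 2N₁)`, `N₁ = (d−1)(L−1)`, the loop constant of p31's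
`abs_argB_loopC_le`; e.g. `N = 17d²L²`), `|φ| ≤ F` on `B(y + e_μ)` and `|(D_uφ)(b)| ≤ D` on the bonds of the runs from `B(y)`, then
**`‖v(b′)(Q(u)φ)(y′) − (Q(u)φ)(y)‖ ≤ 2Nε·F + L·D`**: in the identity `qU_mul_qCov_shift_sub_eq`, `|e^{i·loopAvg}u(loop_x)^{−1} − 1| ≤
|loopAvg| + |argB u(loop_x)| ≤ 2N₃ε` (p31's `abs_loopAvg_le`, `abs_argB_loopC_le`) and `|u(Γ_{xx′})φ(x′) − φ(x)| ≤ L·D`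
(`norm_runC_mul_sub_le`). [cite: BalabanImbrieJaffe1988, (3.32) p.270] -/
theorem norm_qU_mul_qCov_shift_sub_le (hj : j + 1 ≤ P.m + P.K) {U : GaugeField P j U1} (hU : DeltaAx U) {φ : HiggsField P j}
    {ε F D N : ℝ} (hε₀ : 0 ≤ ε) {y : Balaban1983to89.Site P (j+1)} {μ : Fin P.d}
    (hε : ∀ p : Balaban1983to89.Plaq P j, blockOf p.src = y ∨ blockOf p.src = y.shift μ → |argB (toC (plaqHol U p))| ≤ ε)
    (hN : (((P.L - 1) * ((P.d - 1) * (P.L - 1)) + (P.d - 1) * (P.L - 1) * (1 + 2 * ((P.d - 1) * (P.L - 1))) : ℕ) : ℝ) ≤ N)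
    (hπ : N * ε < π) (hφ : ∀ x : Balaban1983to89.Site P j, blockOf x = y.shift μ → ‖φ x‖ ≤ F)
    (hDφ : ∀ x : Balaban1983to89.Site P j, blockOf x = y → ∀ t ∈ range P.L, ‖covD 1 (cfg U) φ (runBond x μ t)‖ ≤ D) :
    ‖toC (qU U ⟨y, μ⟩) * qCov U φ (y.shift μ) - qCov U φ y‖ ≤ 2 * N * ε * F + P.L * D := by
  set N₃ : ℝ := (((P.L - 1) * ((P.d - 1) * (P.L - 1)) + (P.d - 1) * (P.L - 1) * (1 + 2 * ((P.d - 1) * (P.L - 1))) : ℕ) : ℝ) with hN₃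
  have hL : (0 : ℝ) < (P.L : ℝ) ^ P.d := by have := P.L_pos; positivity
  have hNε : N₃ * ε ≤ N * ε := mul_le_mul_of_nonneg_right hN hε₀
  have hπ₃ : N₃ * ε < π := lt_of_le_of_lt hNε hπ
  have hα : |loopAvg U ⟨y, μ⟩| ≤ N₃ * ε := abs_loopAvg_le hj hU hε₀ hε hπ₃
  -- the per-site bound
  have hterm : ∀ x ∈ block y, ‖holC U x *
      (Complex.exp ((loopAvg U ⟨y, μ⟩ : ℂ) * I) * (loopC U ⟨y, μ⟩ x)⁻¹ * (runC U x μ * φ (runSite x μ P.L)) - φ x)‖ ≤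
      2 * N * ε * F + P.L * D := by
    intro x hx
    have hxy : blockOf x = y := mem_block_iff.1 hx
    set w := loopC U ⟨y, μ⟩ x with hw
    set E := Complex.exp ((loopAvg U ⟨y, μ⟩ : ℂ) * I) with hE
    set r := runC U x μ * φ (runSite x μ P.L) with hr
    have hwn : ‖w‖ = 1 := norm_loopC_eq_one U _ x
    have hloop : |argB w| ≤ N₃ * ε := by
      have ex : x = Balaban1983to89.Site.blockSite y (offs x) := by rw [← hxy, blockSite_offs hj]
      rw [hw, ex]
      exact abs_argB_loopC_le hj hU hε₀ hε hπ₃ (offs x)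
    -- `E·w⁻¹ = exp(i(loopAvg − argB w))`
    have hEw : E * w⁻¹ = Complex.exp (((loopAvg U ⟨y, μ⟩ - argB w : ℝ) : ℂ) * I) := by
      rw [ofReal_sub, sub_mul, Complex.exp_sub, exp_argB_mul_I_of_norm hwn, hE, div_eq_mul_inv]
    have hEw1 : ‖E * w⁻¹ - 1‖ ≤ 2 * N * ε := by
      rw [hEw]
      refine (norm_cexp_mul_I_sub_one_le _).trans ?_
      calc |loopAvg U ⟨y, μ⟩ - argB w| ≤ |loopAvg U ⟨y, μ⟩| + |argB w| := abs_sub _ _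
        _ ≤ N * ε + N * ε := add_le_add (hα.trans hNε) (hloop.trans hNε)
        _ = 2 * N * ε := by ring
    have hrn : ‖r‖ ≤ F := by
      rw [hr, norm_mul, norm_runC_eq_one, one_mul]
      exact hφ _ (blockOf_runSite_L hj x μ ▸ by rw [hxy])
    have hrun : ‖r - φ x‖ ≤ P.L * D := by
      refine (norm_runC_mul_sub_le U φ x μ).trans ?_
      calc ∑ t ∈ range P.L, ‖covD 1 (cfg U) φ (runBond x μ t)‖ ≤ ∑ _t ∈ range P.L, D := sum_le_sum fun t ht => hDφ x hxy t ht
        _ = P.L * D := by rw [sum_const, card_range, nsmul_eq_mul]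
    have h2N : 0 ≤ 2 * N * ε := by nlinarith [mul_nonneg (hN₃ ▸ (Nat.cast_nonneg _ : (0:ℝ) ≤ N₃)) hε₀]
    rw [norm_mul, norm_holC, one_mul,
      show E * w⁻¹ * r - φ x = (E * w⁻¹ - 1) * r + (r - φ x) by ring]
    calc ‖(E * w⁻¹ - 1) * r + (r - φ x)‖ ≤ ‖(E * w⁻¹ - 1) * r‖ + ‖r - φ x‖ := norm_add_le _ _
      _ ≤ 2 * N * ε * F + P.L * D := by
          rw [norm_mul]
          exact add_le_add (mul_le_mul hEw1 hrn (norm_nonneg _) h2N) hrun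
  rw [qU_mul_qCov_shift_sub_eq hj, norm_mul, norm_inv, norm_pow, Complex.norm_natCast]
  have hsum := (norm_sum_le _ _).trans (sum_le_sum hterm)
  rw [sum_const, nsmul_eq_mul, Balaban1983to89.Site.card_block hj, Nat.cast_pow] at hsum
  calc ((P.L : ℝ) ^ P.d)⁻¹ * ‖∑ x ∈ block y, holC U x *
        (Complex.exp ((loopAvg U ⟨y, μ⟩ : ℂ) * I) * (loopC U ⟨y, μ⟩ x)⁻¹ * (runC U x μ * φ (runSite x μ P.L)) - φ x)‖
      ≤ ((P.L : ℝ) ^ P.d)⁻¹ * ((P.L : ℝ) ^ P.d * (2 * N * ε * F + P.L * D)) := mul_le_mul_of_nonneg_left hsum (inv_nonneg.2 hL.le)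
    _ = 2 * N * ε * F + P.L * D := by field_simp

/-- kernel: every site of a run from `x ∈ B(y)` up to `x′ = x + Le_μ` lies in `B(y)` or in `B(y + e_μ)`.
[cite: BalabanImbrieJaffe1985, (2.10) p.303] -/
private theorem blockOf_runSite_mem (hj : j + 1 ≤ P.m + P.K) (x : Balaban1983to89.Site P j) (μ : Fin P.d) {t : ℕ} (ht : t ≤ P.L) :
    blockOf (runSite x μ t) = blockOf x ∨ blockOf (runSite x μ t) = (blockOf x).shift μ := by
  by_cases h : inBlock x μ + t < P.L
  · exact Or.inl (blockOf_runSite_lo hj x μ h)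
  · right
    rw [runSite_eq_blockSite_hi hj x μ (not_lt.1 h) ht, Balaban1983to89.Site.blockOf_blockSite hj]

/-- **(3.32), third clause** *"|(D_{ū₁}ψ)(b′)| ≦ cp(e₀), b′ ∈ Λ₀^{(0)′*}"* read for the block gauge field `v = Qu` (READING (a) of the
header), from the four clauses of (3.15): for `b′ = ⟨y, y′⟩ ∈ Λ′*`, a coarse prefactor `c′ ≥ 0` and a constant `N ≥ N₃` with
`N·e₀p(e₀) < π`,
`|(D_vψ)(b′)| = c′|v(b′)ψ(y′) − ψ(y)| ≤ c′[|ψ(y′) − (Qφ)(y′)| + |v(b′)(Qφ)(y′) − (Qφ)(y)| + |(Qφ)(y) − ψ(y)|]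
≤ c′[(L + 2)p(e₀) + 2N·e₀p(e₀)·λ₀^{−1/4}p(e₀)]` (`norm_qU_mul_qCov_shift_sub_le` with `ε = e₀p(e₀)`, `F = λ₀^{−1/4}p(e₀)`, `D = p(e₀)`).
[cite: BalabanImbrieJaffe1988, (3.32) p.270] -/
theorem norm_covD_qU_psi_le_of_smallField315 (hj : j + 1 ≤ P.m + P.K) {U : GaugeField P j U1} (hU : DeltaAx U)
    {e₀ pe₀ lam₀ N : ℝ} (he : 0 < e₀) (hpe : 0 ≤ pe₀)
    {Λ : Finset (Balaban1983to89.Site P j)} {Λ' : Finset (Balaban1983to89.Site P (j+1))}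
    {ψ : Balaban1983to89.Site P (j+1) → ℂ} {φ : HiggsField P j}
    (h : SmallField315 pe₀ lam₀ Λ Λ' (covD 1 (cfg U) φ) ψ (qCov U φ) φ (fun p => ‖fieldStrength e₀ (plaqVar (cfg U) p)‖))
    (hΛ₁ : ∀ x : Balaban1983to89.Site P j, blockOf x ∈ Λ' → x ∈ Λ)
    (hΛ₂ : ∀ p : Balaban1983to89.Plaq P j, blockOf p.src ∈ Λ' → p ∈ starP Λ)
    (hN : (((P.L - 1) * ((P.d - 1) * (P.L - 1)) + (P.d - 1) * (P.L - 1) * (1 + 2 * ((P.d - 1) * (P.L - 1))) : ℕ) : ℝ) ≤ N)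
    (hπ : N * (e₀ * pe₀) < π) {c' : ℝ} (hc0 : 0 ≤ c') (b' : PBond P (j+1)) (hb' : b' ∈ starB Λ') :
    ‖covD c' (cfg (qU U)) ψ b'‖ ≤ c' * ((P.L + 2) * pe₀ + 2 * N * (e₀ * pe₀) * (lam₀ ^ (-(1 / 4 : ℝ)) * pe₀)) := by
  obtain ⟨y, μ⟩ := b'
  obtain ⟨hy, hy'⟩ := mem_starB.1 hb'
  change y ∈ Λ' at hy
  change y.shift μ ∈ Λ' at hy'
  have hsmall := plaqSmall_of_smallField315 he h
  obtain ⟨hD, hψ, hφ, -⟩ := h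
  -- the middle term
  have hmid : ‖toC (qU U ⟨y, μ⟩) * qCov U φ (y.shift μ) - qCov U φ y‖ ≤
      2 * N * (e₀ * pe₀) * (lam₀ ^ (-(1 / 4 : ℝ)) * pe₀) + P.L * pe₀ := by
    refine norm_qU_mul_qCov_shift_sub_le hj hU (mul_nonneg he.le hpe) ?_ hN hπ ?_ ?_
    · intro p hp
      refine hsmall p (hΛ₂ p ?_)
      rcases hp with hp | hp <;> rw [hp] <;> assumption
    · intro x hx
      exact hφ x (hΛ₁ x (by rw [hx]; exact hy'))
    · intro x hx t ht
      refine hD _ (mem_starB.2 ⟨hΛ₁ _ ?_, hΛ₁ _ ?_⟩)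
      · change blockOf (runSite x μ t) ∈ Λ'
        rcases blockOf_runSite_mem hj x μ (mem_range.1 ht).le with h' | h' <;> rw [h', hx] <;> assumption
      · rw [runBond_tgt]
        rcases blockOf_runSite_mem hj x μ (Nat.succ_le_of_lt (mem_range.1 ht)) with h' | h' <;> rw [h', hx] <;> assumption
  have h1 := hψ (y.shift μ) hy'
  have h2 := hψ y hy
  have hv : ‖toC (qU U ⟨y, μ⟩)‖ = 1 := norm_toC _
  have e : covD c' (cfg (qU U)) ψ ⟨y, μ⟩ = (c' : ℂ) * (toC (qU U ⟨y, μ⟩) * (ψ (y.shift μ) - qCov U φ (y.shift μ)) +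
      (toC (qU U ⟨y, μ⟩) * qCov U φ (y.shift μ) - qCov U φ y) + (qCov U φ y - ψ y)) := by
    show (c' : ℂ) * (toC (qU U ⟨y, μ⟩) * ψ (PBond.tgt ⟨y, μ⟩) - ψ y) = _
    rw [show PBond.tgt (⟨y, μ⟩ : PBond P (j+1)) = y.shift μ from rfl]
    ring
  rw [e, norm_mul, Complex.norm_real, Real.norm_eq_abs, abs_of_nonneg hc0]
  refine mul_le_mul_of_nonneg_left ?_ hc0
  calc _ ≤ ‖toC (qU U ⟨y, μ⟩) * (ψ (y.shift μ) - qCov U φ (y.shift μ))‖ +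
        ‖toC (qU U ⟨y, μ⟩) * qCov U φ (y.shift μ) - qCov U φ y‖ + ‖qCov U φ y - ψ y‖ := norm_add₃_le
    _ ≤ pe₀ + (2 * N * (e₀ * pe₀) * (lam₀ ^ (-(1 / 4 : ℝ)) * pe₀) + P.L * pe₀) + pe₀ := by
        refine add_le_add (add_le_add ?_ hmid) ?_
        · rw [norm_mul, hv, one_mul]; exact h1
        · rw [norm_sub_rev]; exact h2
    _ = (P.L + 2) * pe₀ + 2 * N * (e₀ * pe₀) * (lam₀ ^ (-(1 / 4 : ℝ)) * pe₀) := by ring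

/-- **Perturbation of the coarse gauge field in the covariant derivative** (for READING (a): print's `ū₁(b′)` is `v(b′)` times the
(3.27)/(3.28) correction factor): for ANY coarse bond field `w`,
`‖(D_wψ)(b′)‖ ≤ ‖(D_vψ)(b′)‖ + |c′|·‖w(b′) − v(b′)‖·‖ψ(b′₊)‖`. [cite: BalabanImbrieJaffe1988, (3.32) p.270] -/
theorem norm_covD_perturb_le (c' : ℝ) (w v : PBond P (j+1) → ℂ) (ψ : Balaban1983to89.Site P (j+1) → ℂ) (b' : PBond P (j+1)) :
    ‖covD c' w ψ b'‖ ≤ ‖covD c' v ψ b'‖ + |c'| * ‖w b' - v b'‖ * ‖ψ b'.tgt‖ := by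
  have e : covD c' w ψ b' = covD c' v ψ b' + (c' : ℂ) * ((w b' - v b') * ψ b'.tgt) := by
    show (c' : ℂ) * (w b' * ψ b'.tgt - ψ b'.src) = (c' : ℂ) * (v b' * ψ b'.tgt - ψ b'.src) + _
    ring
  rw [e]
  refine (norm_add_le _ _).trans (add_le_add le_rfl (le_of_eq ?_))
  rw [norm_mul, norm_mul, Complex.norm_real, Real.norm_eq_abs, mul_assoc]

/-! ## §5  (3.15) ⟹ (3.32) for the typed predicates -/

/-- kernel: `L + 3 ≤ 17d²L²` and `2 ≤ 17d²L²` (so one constant serves the three clauses). [folklore] -/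
private theorem L_add_three_le_seventeen :
    (P.L : ℝ) + 3 ≤ 17 * (P.d : ℝ) ^ 2 * (P.L : ℝ) ^ 2 ∧ (2 : ℝ) ≤ 17 * (P.d : ℝ) ^ 2 * (P.L : ℝ) ^ 2 := by
  have hd : (1 : ℝ) ≤ P.d := by exact_mod_cast P.hd
  have hL : (2 : ℝ) ≤ P.L := by exact_mod_cast P.hL.2
  have hd2 : (1 : ℝ) ≤ (P.d : ℝ) ^ 2 := by nlinarith
  have hL2 : (P.L : ℝ) + 3 ≤ 17 * (P.L : ℝ) ^ 2 := by nlinarith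
  constructor
  · calc (P.L : ℝ) + 3 ≤ 17 * (P.L : ℝ) ^ 2 := hL2
      _ = 17 * 1 * (P.L : ℝ) ^ 2 := by ring
      _ ≤ 17 * (P.d : ℝ) ^ 2 * (P.L : ℝ) ^ 2 := by gcongr
  · calc (2 : ℝ) ≤ 17 * 1 * 2 ^ 2 := by norm_num
      _ ≤ 17 * (P.d : ℝ) ^ 2 * (P.L : ℝ) ^ 2 := by gcongr

/-- **(3.15) ⟹ (3.32)** (p. 270: *"In the small field region Λ₀^{(0)} we have small block fields … (3.32)"*) FOR THE TYPED PREDICATES AT THE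
OBJECTS OF RECORD: if `u` (axial gauge of (3.11)) and `φ`, `ψ` satisfy (3.15) on `(Λ, Λ′)` — `|D_uφ| ≤ p(e₀)` on `Λ*`, `|ψ − Q(u)φ| ≤ p(e₀)`
on `Λ′`, `|φ| ≤ λ₀^{−1/4}p(e₀)` on `Λ`, `|f^{(0)}| ≤ p(e₀)` on `Λ**` with `f^{(0)}(p) = ‖(ie₀)⁻¹ log u(∂p)‖` — then the block fields
`v = Qu` ((2.10)), `ψ` satisfy (3.32) on `Λ′` with **`c = 17d²L²`**: `|v(∂p′) − 1| ≤ c·e₀p(e₀)` on `Λ′**`, `|ψ(y)| ≤ c·p(e₀)λ₀^{−1/4}` on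
`Λ′`, `|(D_vψ)(b′)| ≤ c·p(e₀)` on `Λ′*` (coarse prefactor `0 ≤ c′ ≤ 1`), under the margin `hΛ₁`/`hΛ₂` (READING (c)), `0 < λ₀ ≤ 1`,
`17d²L²·e₀p(e₀) < π` and `2·17d²L²·e₀p(e₀) ≤ λ₀^{1/4}` (READING (d)). [cite: BalabanImbrieJaffe1988, (3.32) p.270] -/
theorem smallBlock332_of_smallField315 (hj : j + 1 ≤ P.m + P.K) {U : GaugeField P j U1} (hU : DeltaAx U)
    {e₀ pe₀ lam₀ : ℝ} (he : 0 < e₀) (hpe : 0 ≤ pe₀) (hlam : 0 < lam₀) (hlam1 : lam₀ ≤ 1)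
    (hπ : 17 * (P.d : ℝ) ^ 2 * (P.L : ℝ) ^ 2 * (e₀ * pe₀) < π)
    (hsm : 2 * (17 * (P.d : ℝ) ^ 2 * (P.L : ℝ) ^ 2) * (e₀ * pe₀) ≤ lam₀ ^ (1 / 4 : ℝ))
    {Λ : Finset (Balaban1983to89.Site P j)} {Λ' : Finset (Balaban1983to89.Site P (j+1))}
    (hΛ₁ : ∀ x : Balaban1983to89.Site P j, blockOf x ∈ Λ' → x ∈ Λ)
    (hΛ₂ : ∀ p : Balaban1983to89.Plaq P j, blockOf p.src ∈ Λ' → p ∈ starP Λ)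
    {ψ : Balaban1983to89.Site P (j+1) → ℂ} {φ : HiggsField P j} {c' : ℝ} (hc0 : 0 ≤ c') (hc1 : c' ≤ 1)
    (h : SmallField315 pe₀ lam₀ Λ Λ' (covD 1 (cfg U) φ) ψ (qCov U φ) φ (fun p => ‖fieldStrength e₀ (plaqVar (cfg U) p)‖)) :
    SmallBlock332 (17 * (P.d : ℝ) ^ 2 * (P.L : ℝ) ^ 2) e₀ pe₀ lam₀ Λ' (plaqVar (cfg (qU U))) ψ (covD c' (cfg (qU U)) ψ) := by
  set C : ℝ := 17 * (P.d : ℝ) ^ 2 * (P.L : ℝ) ^ 2 with hC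
  have hε₀ : 0 ≤ e₀ * pe₀ := mul_nonneg he.le hpe
  have hsmall := plaqSmall_of_smallField315 he h
  obtain ⟨hN3C, -⟩ := loopConst_le_seventeen (P := P)
  obtain ⟨hLC, h2C⟩ := L_add_three_le_seventeen (P := P)
  have hC0 : (0 : ℝ) ≤ C := by positivity
  have hpow : 0 < lam₀ ^ (-(1 / 4 : ℝ)) := Real.rpow_pos_of_pos hlam _
  have hpow' : lam₀ ^ (-(1 / 4 : ℝ)) * lam₀ ^ (1 / 4 : ℝ) = 1 := by
    rw [← Real.rpow_add hlam]; norm_num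
  -- the quadratic smallness: `2C·e₀p·λ₀^{−1/4}·p ≤ p`
  have hquad : 2 * C * (e₀ * pe₀) * (lam₀ ^ (-(1 / 4 : ℝ)) * pe₀) ≤ pe₀ := by
    have h2 : 2 * C * (e₀ * pe₀) * lam₀ ^ (-(1 / 4 : ℝ)) ≤ 1 := by
      calc 2 * C * (e₀ * pe₀) * lam₀ ^ (-(1 / 4 : ℝ)) ≤ lam₀ ^ (1 / 4 : ℝ) * lam₀ ^ (-(1 / 4 : ℝ)) :=
            mul_le_mul_of_nonneg_right hsm hpow.le
        _ = 1 := by rw [mul_comm, hpow']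
    calc 2 * C * (e₀ * pe₀) * (lam₀ ^ (-(1 / 4 : ℝ)) * pe₀) = (2 * C * (e₀ * pe₀) * lam₀ ^ (-(1 / 4 : ℝ))) * pe₀ := by ring
      _ ≤ 1 * pe₀ := mul_le_mul_of_nonneg_right h2 hpe
      _ = pe₀ := one_mul _
  refine ⟨fun q hq => ?_, fun y hy => ?_, fun b' hb' => ?_⟩
  · -- first clause
    calc ‖plaqVar (cfg (qU U)) q - 1‖ ≤ C * (e₀ * pe₀) := norm_plaqVar_qU_sub_one_le hj hU hε₀ hΛ₂ hsmall hπ q hq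
      _ = C * e₀ * pe₀ := by ring
  · -- second clause
    calc ‖ψ y‖ ≤ 2 * pe₀ * lam₀ ^ (-(1 / 4 : ℝ)) := norm_psi_le_of_smallField315 hj hpe hlam hlam1 h hΛ₁ y hy
      _ ≤ C * pe₀ * lam₀ ^ (-(1 / 4 : ℝ)) := by gcongr
  · -- third clause
    have h3 := norm_covD_qU_psi_le_of_smallField315 hj hU he hpe h hΛ₁ hΛ₂ hN3C hπ hc0 b' hb'
    calc ‖covD c' (cfg (qU U)) ψ b'‖ ≤ c' * ((P.L + 2) * pe₀ + 2 * C * (e₀ * pe₀) * (lam₀ ^ (-(1 / 4 : ℝ)) * pe₀)) := h3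
      _ ≤ 1 * ((P.L + 2) * pe₀ + pe₀) := by gcongr
      _ = (P.L + 3) * pe₀ := by ring
      _ ≤ C * pe₀ := mul_le_mul_of_nonneg_right hLC hpe

/-! ## §6 (v1.1, append-only)  The axial gauge removed: (3.15) ⟹ (3.32) for every `U(1)` field -/

/-- **`|D_uφ|` is gauge invariant**: `(D_{u^g}(gφ))(b) = g(b₋)·(D_uφ)(b)` for the tree's gauge action and C1's scalar action `twist`, hence
equal moduli ([BalabanImbrieJaffe1985] (2.7)–(2.8); p. 258 of [BalabanImbrieJaffe1988]: the action (3.3) is gauge invariant).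
[cite: BalabanImbrieJaffe1988, (3.3) p.265] -/
theorem norm_covD_gaugeAct_twist (c : ℝ) (g : GaugeTransf P j U1) (U : GaugeField P j U1) (φ : HiggsField P j) (b : PBond P j) :
    ‖covD c (cfg (gaugeAct g U)) (BIJ85RT33.twist g φ) b‖ = ‖covD c (cfg U) φ b‖ := by
  have hne : toC (g b.tgt) ≠ 0 := toC_ne_zero _
  have e : covD c (cfg (gaugeAct g U)) (BIJ85RT33.twist g φ) b = toC (g b.src) * covD c (cfg U) φ b := by
    show (c : ℂ) * (toC (gaugeAct g U b) * (toC (g b.tgt) * φ b.tgt) - toC (g b.src) * φ b.src) =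
      toC (g b.src) * ((c : ℂ) * (toC (U b) * φ b.tgt - φ b.src))
    rw [toC_gaugeAct]
    field_simp
  rw [e, norm_mul, norm_toC, one_mul]

/-- **The plaquette variable is gauge invariant** (abelian group): `u^g(∂p) = u(∂p)` read in `ℂ` (`cfg_gaugeAct` + `plaqVar_gauge`).
[cite: BalabanImbrieJaffe1988, (3.3) p.265] -/
theorem toC_plaqHol_gaugeAct (g : GaugeTransf P j U1) (U : GaugeField P j U1) (p : Balaban1983to89.Plaq P j) :
    toC (plaqHol (gaugeAct g U) p) = toC (plaqHol U p) := by
  rw [← plaqVar_cfg, ← plaqVar_cfg, BIJ88RenormTransf311.cfg_gaugeAct, BIJ88Sect3Statements.plaqVar_gauge]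

/-- **The axial-gauge fixing does not move the covariant block average**: `Q(u^h)(hφ) = Q(u)φ` for `h(x) = u(Γ_{yx})`, because `h = 1` at the
block corners ((2.8) `Q(u^h)φ^h = h(y)·Q(u)φ`, `holFix_corner`). [cite: BalabanImbrieJaffe1985, (2.8) p.303] -/
theorem qCov_gaugeAct_holFix (hj : j + 1 ≤ P.m + P.K) (U : GaugeField P j U1) (φ : HiggsField P j) :
    qCov (gaugeAct (BIJ85AxialGaugeFixTorus.holFix U) U) (BIJ85RT33.twist (BIJ85AxialGaugeFixTorus.holFix U) φ) = qCov U φ := by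
  funext y
  rw [qCov_gaugeAct_twist hj, BIJ85AxialGaugeFixTorus.holFix_corner hj, toC_one, one_mul]

/-- **… nor the block gauge field**: `Q(u^h) = Qu` for `h(x) = u(Γ_{yx})` ((2.10) commutes with gauge transformations, `qU_gaugeAct`, and
`h ∘ corner = 1`). [cite: BalabanImbrieJaffe1985, (2.10) p.303] -/
theorem qU_gaugeAct_holFix (hj : j + 1 ≤ P.m + P.K) (U : GaugeField P j U1) :
    qU (gaugeAct (BIJ85AxialGaugeFixTorus.holFix U) U) = qU U := by
  rw [qU_gaugeAct hj]
  funext c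
  show BIJ85AxialGaugeFixTorus.holFix U (corner c.src) * qU U c * (BIJ85AxialGaugeFixTorus.holFix U (corner c.tgt))⁻¹ = qU U c
  rw [BIJ85AxialGaugeFixTorus.holFix_corner hj, BIJ85AxialGaugeFixTorus.holFix_corner hj, one_mul, inv_one, mul_one]

/-- **(3.15) transfers to the axial representative**: if `(u, φ, ψ)` satisfies (3.15) at the objects of record, so does
`(u^h, hφ, ψ)` with `h(x) = u(Γ_{yx})` (same `ψ`, same regions, same constants) — `|D_uφ|`, `|φ|`, `|u(∂p)|` are invariant and
`Q(u^h)(hφ) = Q(u)φ`. [cite: BalabanImbrieJaffe1988, (3.15) p.267] -/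
theorem smallField315_gaugeAct_holFix (hj : j + 1 ≤ P.m + P.K) {pe₀ lam₀ e₀ : ℝ} {Λ : Finset (Balaban1983to89.Site P j)}
    {Λ' : Finset (Balaban1983to89.Site P (j+1))} {ψ : Balaban1983to89.Site P (j+1) → ℂ} {φ : HiggsField P j} {U : GaugeField P j U1}
    (h : SmallField315 pe₀ lam₀ Λ Λ' (covD 1 (cfg U) φ) ψ (qCov U φ) φ (fun p => ‖fieldStrength e₀ (plaqVar (cfg U) p)‖)) :
    SmallField315 pe₀ lam₀ Λ Λ' (covD 1 (cfg (gaugeAct (BIJ85AxialGaugeFixTorus.holFix U) U))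
        (BIJ85RT33.twist (BIJ85AxialGaugeFixTorus.holFix U) φ)) ψ
      (qCov (gaugeAct (BIJ85AxialGaugeFixTorus.holFix U) U) (BIJ85RT33.twist (BIJ85AxialGaugeFixTorus.holFix U) φ))
      (BIJ85RT33.twist (BIJ85AxialGaugeFixTorus.holFix U) φ)
      (fun p => ‖fieldStrength e₀ (plaqVar (cfg (gaugeAct (BIJ85AxialGaugeFixTorus.holFix U) U)) p)‖) := by
  obtain ⟨h1, h2, h3, h4⟩ := h
  refine ⟨fun b hb => ?_, fun y hy => ?_, fun x hx => ?_, fun p hp => ?_⟩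
  · rw [norm_covD_gaugeAct_twist]; exact h1 b hb
  · rw [qCov_gaugeAct_holFix hj]; exact h2 y hy
  · rw [show BIJ85RT33.twist (BIJ85AxialGaugeFixTorus.holFix U) φ x = toC (BIJ85AxialGaugeFixTorus.holFix U x) * φ x from rfl,
      norm_mul, norm_toC, one_mul]
    exact h3 x hx
  · have e : plaqVar (cfg (gaugeAct (BIJ85AxialGaugeFixTorus.holFix U) U)) p = plaqVar (cfg U) p := by
      rw [plaqVar_cfg, plaqVar_cfg, toC_plaqHol_gaugeAct]
    dsimp only
    rw [e]
    exact h4 p hp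

/-- **(3.15) ⟹ (3.32) FOR EVERY `U(1)` FIELD — no gauge condition** (READING (b) of the header discharged): the block fields `v = Qu`, `ψ` and
`D_vψ` are unchanged by the axial-gauge fixing `h(x) = u(Γ_{yx})` ([BalabanImbrieJaffe1985] p. 303 *"In axial gauge we choose h in order to
set u_b = 1 for every b which occurs in some Γ_{yx}"*; `BIJ85AxialGaugeFixTorus.deltaAx_gaugeAct_holFix`), (3.15) transfers to `(u^h, hφ, ψ)`
(`smallField315_gaugeAct_holFix`), and `smallBlock332_of_smallField315` applies in that gauge; same constant `c = 17d²L²`, same margin and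
smallness hypotheses. [cite: BalabanImbrieJaffe1988, (3.32) p.270] -/
theorem smallBlock332_of_smallField315_all (hj : j + 1 ≤ P.m + P.K) (U : GaugeField P j U1)
    {e₀ pe₀ lam₀ : ℝ} (he : 0 < e₀) (hpe : 0 ≤ pe₀) (hlam : 0 < lam₀) (hlam1 : lam₀ ≤ 1)
    (hπ : 17 * (P.d : ℝ) ^ 2 * (P.L : ℝ) ^ 2 * (e₀ * pe₀) < π)
    (hsm : 2 * (17 * (P.d : ℝ) ^ 2 * (P.L : ℝ) ^ 2) * (e₀ * pe₀) ≤ lam₀ ^ (1 / 4 : ℝ))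
    {Λ : Finset (Balaban1983to89.Site P j)} {Λ' : Finset (Balaban1983to89.Site P (j+1))}
    (hΛ₁ : ∀ x : Balaban1983to89.Site P j, blockOf x ∈ Λ' → x ∈ Λ)
    (hΛ₂ : ∀ p : Balaban1983to89.Plaq P j, blockOf p.src ∈ Λ' → p ∈ starP Λ)
    {ψ : Balaban1983to89.Site P (j+1) → ℂ} {φ : HiggsField P j} {c' : ℝ} (hc0 : 0 ≤ c') (hc1 : c' ≤ 1)
    (h : SmallField315 pe₀ lam₀ Λ Λ' (covD 1 (cfg U) φ) ψ (qCov U φ) φ (fun p => ‖fieldStrength e₀ (plaqVar (cfg U) p)‖)) :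
    SmallBlock332 (17 * (P.d : ℝ) ^ 2 * (P.L : ℝ) ^ 2) e₀ pe₀ lam₀ Λ' (plaqVar (cfg (qU U))) ψ (covD c' (cfg (qU U)) ψ) := by
  have key := smallBlock332_of_smallField315 hj (BIJ85AxialGaugeFixTorus.deltaAx_gaugeAct_holFix hj U) he hpe hlam hlam1 hπ hsm hΛ₁ hΛ₂
    hc0 hc1 (smallField315_gaugeAct_holFix hj h)
  rwa [qU_gaugeAct_holFix hj] at key

end

end Literature.MathematicalPhysics.QuantumFieldTheory.BalabanImbrieJaffe1984to88.BIJ88SmallBlockFields332
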